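import Mathlib.Analysis.Calculus.FDeriv.Mul
import Mathlib.Analysis.Calculus.FDeriv.Prod
import Mathlib.Analysis.Matrix.Normed
import Mathlib.LinearAlgebra.Matrix.Adjugate
import HarnessLib

/-!
# The Chevalley map `X ↦ (tr X, tr adj X, det X)` of `M₃(𝕜)` is STRICTLY differentiable, with derivative `Y ↦ (tr Y, tr X·tr Y − tr (XY), tr (adj X·Y))`
# (any nontrivially normed field `𝕜`, sup norm on matrices)

ROAD «HC-D» (cell `pub/hodgecm-mathlib`, crux H413 = `stmt-HodgeConjecture-24833`, lane `--supports …`), rider (H-strict) of brick (D4a), asked BY NAME by the road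
holder F0P2-p01 (g23) (bus F0∕P2 2026-09-02T16:16:05Z) — the hypothesis `HasStrictFDerivAt P P′ x₀` that the road's D2 `exists_depth_submersion` consumes at a regular
`X₀`.  THEOREMS ONLY; Mathlib-only imports; companion of ★ `Literature.LinearAlgebra.Matrix.CubicChevalleyDifferential` (the EXACT expansions and «onto ⟺ regular»).

Over an ultrametric field `C¹` does not imply strict differentiability (`ContDiffAt.hasStrictFDerivAt` is `RCLike`-only), so the proof is by the STRICT product
rule: the nine coordinates `X ↦ X i j` are continuous linear (`hasStrictFDerivAt_apply` twice), `tr adj X` and `det X` are the explicit quadratic ∕ cubic polynomials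
`Matrix.adjugate_fin_three` ∕ `Matrix.det_fin_three` in them (`HasStrictFDerivAt.mul ∕ add ∕ sub`), and the resulting derivative is IDENTIFIED with the trace pairings
against the gradients `1`, `tr X·1 − X`, `adj X` by evaluating on `Y` and `ring` (Jacobi's formula [HornJohnson2013 (0.8.10.1)]).  Instances: the sup-norm
`Matrix.normedAddCommGroup ∕ Matrix.normedSpace` (local, as in Mathlib `Analysis.Matrix`).

* `hasStrictFDerivAt_entry` — `X ↦ X i j`.
* `hasStrictFDerivAt_trace`, `hasStrictFDerivAt_trace_adjugate`, `hasStrictFDerivAt_det` — each with an EXPLICIT continuous linear derivative `L` and its value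
  `L Y = tr Y ∕ tr X·tr Y − tr (XY) ∕ tr (adj X·Y)` (stated as `∃ L, (∀ Y, L Y = …) ∧ HasStrictFDerivAt … L X` — no definition is introduced).
* **`hasStrictFDerivAt_chevalley`** — `∃ L : M₃(𝕜) →L[𝕜] 𝕜 × 𝕜 × 𝕜, (∀ Y, L Y = (tr Y, tr X·tr Y − tr (XY), tr (adj X·Y))) ∧ HasStrictFDerivAt (fun X ↦ (tr X, tr adj X, det X)) L X`.

## References
* [HornJohnson2013] R. A. Horn, C. R. Johnson, *Matrix Analysis*, 2nd ed. (2013): §0.8.10 (0.8.10.1) (`d det A = tr (adj A · dA)`), §1.2 (1.2.13) (`E₂ = tr adj`).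
* W. H. Schikhof, *Ultrametric calculus* (1984), §27 (strict differentiability over non-archimedean fields) — context.
-/

set_option autoImplicit false

open Matrix

namespace Literature.LinearAlgebra.Matrix.CubicChevalleyStrictDeriv

attribute [local instance] Matrix.normedAddCommGroup Matrix.normedSpace

variable {𝕜 : Type*} [NontriviallyNormedField 𝕜]

/-- **The coordinate `X ↦ X i j` is strictly differentiable** (it is continuous linear), with derivative `Y ↦ Y i j`. [cite: HornJohnson2013, §0.8.10 (0.8.10.1)] -/
theorem hasStrictFDerivAt_entry (i j : Fin 3) (X : Matrix (Fin 3) (Fin 3) 𝕜) :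
    ∃ L : Matrix (Fin 3) (Fin 3) 𝕜 →L[𝕜] 𝕜, (∀ Y, L Y = Y i j) ∧ HasStrictFDerivAt (fun X : Matrix (Fin 3) (Fin 3) 𝕜 => X i j) L X := by
  have h1 : HasStrictFDerivAt (fun X : Matrix (Fin 3) (Fin 3) 𝕜 => X i)
      (ContinuousLinearMap.proj (R := 𝕜) (φ := fun _ : Fin 3 => Fin 3 → 𝕜) i) X :=
    hasStrictFDerivAt_apply (𝕜 := 𝕜) (F' := fun _ : Fin 3 => Fin 3 → 𝕜) i X
  have h2 : HasStrictFDerivAt (fun r : Fin 3 → 𝕜 => r j) (ContinuousLinearMap.proj (R := 𝕜) (φ := fun _ : Fin 3 => 𝕜) j) (X i) :=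
    hasStrictFDerivAt_apply (𝕜 := 𝕜) (F' := fun _ : Fin 3 => 𝕜) j (X i)
  exact ⟨(ContinuousLinearMap.proj (R := 𝕜) (φ := fun _ : Fin 3 => 𝕜) j).comp (ContinuousLinearMap.proj (R := 𝕜) (φ := fun _ : Fin 3 => Fin 3 → 𝕜) i),
    fun Y => rfl, h2.comp X h1⟩

/-- **The trace is strictly differentiable**, derivative `Y ↦ tr Y`. [cite: HornJohnson2013, §0.8.10 (0.8.10.1)] -/
theorem hasStrictFDerivAt_trace (X : Matrix (Fin 3) (Fin 3) 𝕜) :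
    ∃ L : Matrix (Fin 3) (Fin 3) 𝕜 →L[𝕜] 𝕜, (∀ Y, L Y = trace Y) ∧ HasStrictFDerivAt (fun X : Matrix (Fin 3) (Fin 3) 𝕜 => trace X) L X := by
  obtain ⟨e00, he00, h00⟩ := hasStrictFDerivAt_entry 0 0 X
  obtain ⟨e11, he11, h11⟩ := hasStrictFDerivAt_entry 1 1 X
  obtain ⟨e22, he22, h22⟩ := hasStrictFDerivAt_entry 2 2 X
  have hD : HasStrictFDerivAt (fun X : Matrix (Fin 3) (Fin 3) 𝕜 => trace X) (e00 + e11 + e22) X :=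
    ((h00.add h11).add h22).congr_of_eventuallyEq (Filter.Eventually.of_forall fun A => by simp [trace_fin_three])
  refine ⟨e00 + e11 + e22, fun Y => ?_, hD⟩
  rw [_root_.add_apply, _root_.add_apply, he00, he11, he22, trace_fin_three]

/-- **`E₂ = tr ∘ adj` is strictly differentiable**, derivative `Y ↦ tr X·tr Y − tr (X Y)` (the explicit quadratic `Matrix.adjugate_fin_three`, product rule, then
Jacobi-type identification by `ring`). [cite: HornJohnson2013, §1.2 (1.2.13); §0.8.10 (0.8.10.1)] -/
theorem hasStrictFDerivAt_trace_adjugate (X : Matrix (Fin 3) (Fin 3) 𝕜) :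
    ∃ L : Matrix (Fin 3) (Fin 3) 𝕜 →L[𝕜] 𝕜, (∀ Y, L Y = trace X * trace Y - trace (X * Y)) ∧
      HasStrictFDerivAt (fun X : Matrix (Fin 3) (Fin 3) 𝕜 => trace (adjugate X)) L X := by
  obtain ⟨e00, he00, h00⟩ := hasStrictFDerivAt_entry 0 0 X
  obtain ⟨e01, he01, h01⟩ := hasStrictFDerivAt_entry 0 1 X
  obtain ⟨e02, he02, h02⟩ := hasStrictFDerivAt_entry 0 2 X
  obtain ⟨e10, he10, h10⟩ := hasStrictFDerivAt_entry 1 0 X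
  obtain ⟨e11, he11, h11⟩ := hasStrictFDerivAt_entry 1 1 X
  obtain ⟨e12, he12, h12⟩ := hasStrictFDerivAt_entry 1 2 X
  obtain ⟨e20, he20, h20⟩ := hasStrictFDerivAt_entry 2 0 X
  obtain ⟨e21, he21, h21⟩ := hasStrictFDerivAt_entry 2 1 X
  obtain ⟨e22, he22, h22⟩ := hasStrictFDerivAt_entry 2 2 X
  -- `tr adj X = X₁₁X₂₂ − X₁₂X₂₁ + X₀₀X₂₂ − X₀₂X₂₀ + X₀₀X₁₁ − X₀₁X₁₀`
  have hfun : ∀ A : Matrix (Fin 3) (Fin 3) 𝕜,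
      A 1 1 * A 2 2 - A 1 2 * A 2 1 + (A 0 0 * A 2 2 - A 0 2 * A 2 0) + (A 0 0 * A 1 1 - A 0 1 * A 1 0) = trace (adjugate A) := by
    intro A
    rw [adjugate_fin_three, trace_fin_three]
    simp
  have hD := (((h11.mul h22).sub (h12.mul h21)).add ((h00.mul h22).sub (h02.mul h20))).add ((h00.mul h11).sub (h01.mul h10))
  have hD' := hD.congr_of_eventuallyEq (f₁ := fun X : Matrix (Fin 3) (Fin 3) 𝕜 => trace (adjugate X))
    (Filter.Eventually.of_forall fun A => by simp only [Pi.add_apply, Pi.sub_apply, Pi.mul_apply]; exact hfun A)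
  -- the derivative produced by the product rule, evaluated
  have hDY : ∀ Y : Matrix (Fin 3) (Fin 3) 𝕜,
      (X 1 1 • e22 + X 2 2 • e11 - (X 1 2 • e21 + X 2 1 • e12) + (X 0 0 • e22 + X 2 2 • e00 - (X 0 2 • e20 + X 2 0 • e02)) + (X 0 0 • e11 + X 1 1 • e00 - (X 0 1 • e10 + X 1 0 • e01))) Y =
        trace X * trace Y - trace (X * Y) := fun Y => by
    simp only [_root_.add_apply, _root_.sub_apply, FunLike.coe_smul, Pi.smul_apply, smul_eq_mul, he00, he01, he02,
      he10, he11, he12, he20, he21, he22, trace_fin_three, Matrix.mul_apply, Fin.sum_univ_three]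
    ring
  exact ⟨_, hDY, hD'⟩

/-- **JACOBI'S FORMULA, strict form: `det` is strictly differentiable with derivative `Y ↦ tr (adj X · Y)`** (the explicit cubic `Matrix.det_fin_three`, strict
product rule, then identification with `Matrix.adjugate_fin_three` by `ring`). [cite: HornJohnson2013, §0.8.10 (0.8.10.1)] -/
theorem hasStrictFDerivAt_det (X : Matrix (Fin 3) (Fin 3) 𝕜) :
    ∃ L : Matrix (Fin 3) (Fin 3) 𝕜 →L[𝕜] 𝕜, (∀ Y, L Y = trace (adjugate X * Y)) ∧ HasStrictFDerivAt (fun X : Matrix (Fin 3) (Fin 3) 𝕜 => det X) L X := by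
  obtain ⟨e00, he00, h00⟩ := hasStrictFDerivAt_entry 0 0 X
  obtain ⟨e01, he01, h01⟩ := hasStrictFDerivAt_entry 0 1 X
  obtain ⟨e02, he02, h02⟩ := hasStrictFDerivAt_entry 0 2 X
  obtain ⟨e10, he10, h10⟩ := hasStrictFDerivAt_entry 1 0 X
  obtain ⟨e11, he11, h11⟩ := hasStrictFDerivAt_entry 1 1 X
  obtain ⟨e12, he12, h12⟩ := hasStrictFDerivAt_entry 1 2 X
  obtain ⟨e20, he20, h20⟩ := hasStrictFDerivAt_entry 2 0 X
  obtain ⟨e21, he21, h21⟩ := hasStrictFDerivAt_entry 2 1 X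
  obtain ⟨e22, he22, h22⟩ := hasStrictFDerivAt_entry 2 2 X
  have hD := ((((((h00.mul h11).mul h22).sub ((h00.mul h12).mul h21)).sub ((h01.mul h10).mul h22)).add ((h01.mul h12).mul h20)).add
    ((h02.mul h10).mul h21)).sub ((h02.mul h11).mul h20)
  have hD' := hD.congr_of_eventuallyEq (f₁ := fun X : Matrix (Fin 3) (Fin 3) 𝕜 => det X)
    (Filter.Eventually.of_forall fun A => by simp only [Pi.add_apply, Pi.sub_apply, Pi.mul_apply]; exact (det_fin_three A).symm)
  -- the derivative produced by the product rule, evaluated: Jacobi's `tr (adj X · Y)`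
  have hDY : ∀ Y : Matrix (Fin 3) (Fin 3) 𝕜,
      ((X 0 0 * X 1 1) • e22 + X 2 2 • (X 0 0 • e11 + X 1 1 • e00) - ((X 0 0 * X 1 2) • e21 + X 2 1 • (X 0 0 • e12 + X 1 2 • e00)) - ((X 0 1 * X 1 0) • e22 + X 2 2 • (X 0 1 • e10 + X 1 0 • e01)) + ((X 0 1 * X 1 2) • e20 + X 2 0 • (X 0 1 • e12 + X 1 2 • e01)) + ((X 0 2 * X 1 0) • e21 + X 2 1 • (X 0 2 • e10 + X 1 0 • e02)) - ((X 0 2 * X 1 1) • e20 + X 2 0 • (X 0 2 • e11 + X 1 1 • e02))) Y =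
        trace (adjugate X * Y) := fun Y => by
    simp only [_root_.add_apply, _root_.sub_apply, FunLike.coe_smul, Pi.smul_apply, smul_eq_mul, he00, he01, he02,
      he10, he11, he12, he20, he21, he22, trace_fin_three, Matrix.mul_apply, Fin.sum_univ_three]
    rw [adjugate_fin_three]
    simp
    ring
  exact ⟨_, hDY, hD'⟩

/-- **THE CHEVALLEY MAP IS STRICTLY DIFFERENTIABLE**: at every `X ∈ M₃(𝕜)` there is a continuous linear `L` with
`L Y = (tr Y, tr X·tr Y − tr (XY), tr (adj X·Y))` and `HasStrictFDerivAt (X ↦ (tr X, tr adj X, det X)) L X` — the hypothesis of the road's submersion lemma at a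
regular `X` (where `L` is onto by ★ `CubicChevalleyDifferential.surjective_differential_iff`). [cite: HornJohnson2013, §0.8.10 (0.8.10.1); §1.2 (1.2.13)] -/
theorem hasStrictFDerivAt_chevalley (X : Matrix (Fin 3) (Fin 3) 𝕜) :
    ∃ L : Matrix (Fin 3) (Fin 3) 𝕜 →L[𝕜] 𝕜 × 𝕜 × 𝕜,
      (∀ Y, L Y = (trace Y, trace X * trace Y - trace (X * Y), trace (adjugate X * Y))) ∧
        HasStrictFDerivAt (fun X : Matrix (Fin 3) (Fin 3) 𝕜 => (trace X, trace (adjugate X), det X)) L X := by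
  obtain ⟨L₁, hL₁, h₁⟩ := hasStrictFDerivAt_trace X
  obtain ⟨L₂, hL₂, h₂⟩ := hasStrictFDerivAt_trace_adjugate X
  obtain ⟨L₃, hL₃, h₃⟩ := hasStrictFDerivAt_det X
  exact ⟨L₁.prod (L₂.prod L₃), fun Y => by rw [ContinuousLinearMap.prod_apply, ContinuousLinearMap.prod_apply, hL₁, hL₂, hL₃], h₁.prodMk (h₂.prodMk h₃)⟩

end Literature.LinearAlgebra.Matrix.CubicChevalleyStrictDeriv
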